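import Literature.Barriers.ValiantsHypothesis.CKRST20NaturalProofsExist
import Literature.Computability.AlgebraicComplexity.HittingSetsCoefficientCover
import Literature.Computability.AlgebraicComplexity.BurgisserBooleanParts
import HarnessLib

/-!
# CKRST20 — hitting sets for exponential sums WITHOUT coefficient restriction
# (Chatterjee–Kumar–Ramya–Saptharishi–Tengse 2020, arXiv v4 Lemma 3.7, over `ℂ`)

Companion of `CKRST20NaturalProofsExist.lean`. The v2 text of CKRST proves hitting sets for the
`s`-definable polynomials WITH coefficients in a finite `Δ ⊂ ℤ` (‹Lemma 23›, discharged in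
`CKRST20DefinableEquationsProofs.lean`); arXiv v4 Lemma 3.7 drops the restriction ("there are
constants `c′, e′` such that `ExpSum_{d,s}(n)` has (non-explicit) hitting sets `ℋ ⊂ [(nds)^{c′}]ⁿ`
of size `(nds)^{e′}`", via [HS80a]). Here the Δ-free statement is PROVED over `ℂ` for CKRST's
definable slice from t20's universal map for definable polynomials (`CKRST2020_lemma20_holds`) and
the tree's abstract hitting-set theorem `CoeffCover.exists_hittingSet` (zero-pattern counting in
place of [HS80a]):

* `CKRST2020.exists_hittingSet_definableSlice` — one exponent `e` such that for `1 ≤ n ≤ s`,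
  `s ≥ 2` and every finite `S ⊂ ℂ` with `|S| ≥ 2s`, some `H ⊆ Sⁿ` with
  `#H ≤ s^e · (log₂(|S|ⁿ s^e + 1) + 1) + 1` hits every nonzero member of `definableSlice ℂ n d s`
  (all `d`).

Honest framing: an existence statement for hitting sets (the VNP analogue of Heintz–Schnorr);
nothing here bears on FSV Question 6 / succinctness or on VP ≠ VNP.

## References

* [ChatterjeeKumarRamyaSaptharishiTengse2020] arXiv v4 Lemma 3.7 (cf. v2 ‹Lemma 23›, ECCC Lemma 5.8).
  locator: paper:arxiv-2004.14147 p0014.txt:L59.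
* [HeintzSchnorr1980] Thm. 4.4.
-/

noncomputable section

namespace Literature.Barriers.ValiantsHypothesis

open Literature.Computability.AlgebraicComplexity MvPolynomial

namespace CKRST2020

/-- An `s`-definable polynomial has degree `≤ s` (Boolean sums do not raise the degree), so the
slice of degree `≤ d` lies in the slice of degree `≤ min d s`.
[cite: ChatterjeeKumarRamyaSaptharishiTengse2020, Def. 5.1 (ECCC) = v2 ‹Def 14›] -/
theorem definableSlice_subset_definableSlice_min {n d s : ℕ} :
    definableSlice ℂ n d s ⊆ definableSlice ℂ n (min d s) s := by
  rintro f ⟨hfd, hn, g, hgd, hgc, hfg⟩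
  refine ⟨le_min hfd ?_, hn, g, hgd, hgc, hfg⟩
  rw [hfg]
  exact (totalDegree_boolSum_le g).trans hgd

/-- **CKRST 2020, arXiv v4 Lemma 3.7 over `ℂ` (hitting sets for exponential sums, no coefficient
restriction) — PROVED.** One exponent `e` such that for all `1 ≤ n ≤ s`, `s ≥ 2`, all `d`, and
every finite `S ⊂ ℂ` with `|S| ≥ 2s`, there is `H ⊆ Sⁿ` with `#H ≤ s^e (log₂(|S|ⁿ s^e + 1) + 1) + 1`
hitting every nonzero `s`-definable `n`-variate polynomial of degree `≤ d`.
[cite: ChatterjeeKumarRamyaSaptharishiTengse2020, Lemma 3.7 (arXiv v4)] -/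
theorem exists_hittingSet_definableSlice :
    ∃ e : ℕ, ∀ (n d s : ℕ), 1 ≤ n → n ≤ s → 2 ≤ s → ∀ S : Finset ℂ, 2 * s ≤ S.card →
      ∃ H : Finset (Fin n → ℂ), (∀ a ∈ H, ∀ i, a i ∈ S) ∧
        H.card ≤ s ^ e * (Nat.log 2 (S.card ^ n * s ^ e + 1) + 1) + 1 ∧
        ∀ f ∈ definableSlice ℂ n d s, f ≠ 0 → ∃ a ∈ H, eval a f ≠ 0 := by
  classical
  obtain ⟨e, h20⟩ := CKRST2020_lemma20_holds
  refine ⟨e, fun n d s hn hns hs S hS => ?_⟩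
  obtain ⟨r, U, hr, hUdeg, hcov⟩ := h20 n (min d s) s hn hns hs
  have hM : ({m : Fin n →₀ ℕ | m.degree ≤ min d s} : Set _).Finite :=
    Finsupp.finite_of_degree_le (σ := Fin n) (min d s)
  have hS1 : S.Nonempty := Finset.card_pos.mp (by omega)
  have hS2 : 2 * min d s ≤ S.card := le_trans (Nat.mul_le_mul_left 2 (min_le_right d s)) hS
  obtain ⟨H, hHS, hHcard, hhit⟩ :=
    CoeffCover.exists_hittingSet (F := ℂ) n (min d s) r (s ^ e) hM U hUdeg S hS1 hS2
  refine ⟨H, hHS, hHcard.trans ?_, fun f hf hf0 => ?_⟩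
  · exact Nat.add_le_add_right (Nat.mul_le_mul_right _ hr) 1
  · have hf' : f ∈ definableSlice ℂ n (min d s) s := definableSlice_subset_definableSlice_min hf
    obtain ⟨y, hy⟩ := hcov f hf'
    exact hhit f hf'.1 ⟨y, fun m => by rw [hy m, coeffVector_apply]⟩ hf0

end CKRST2020

end Literature.Barriers.ValiantsHypothesis

end
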